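import Mathlib
import Summits.HodgeConjecture.FermatCycles.HodgeFermatHypUOdd

/-!
# LEMMA S⁺ — the level inequality at EVERY odd level, squarefree or not — part 1: `tauP`, `GoodP`, the tail (`HodgeFermat/HypUPlus.lean`; HF-G26)

Tree copy (part 1 of 3) of the module `HodgeFermat/HypUPlus.lean` of the sibling cell's standalone package
`run/shared/lean/pub/pub-hodgefermat/lean/HodgeFermat/` (778 lines, sha256 `f3c5085dc93f3a67…`), source lines 36–316 (§1 the general cofactor `npart`, `tauP`, `GoodP`; §2 the tail at every odd level `goodTailP`).
Filed by cell `pub-hfermat`, seat prover-1 gen-3, on the COORDINATOR KEEPER RULING of 2026-08-25 (gem sweep H1: take the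
off-gate kernel theorem `thmFstar` through the gate) — here THEOREM F* of `tables/DPRIME-THEOREM.md` §9 IN FULL, i.e.
PROPOSITION D′(3N) and the descent (`HodgeFermat/PropDPrimeNFinal.lean`, GATE HF-G34), the last off-gate form of THEOREM F*
(its first two forms, `DecodingFinal.thmFstar` = F* at the prime levels and `ThmFstarNFinal.thmFstar` = F*(3N), landed on
2026-08-25 as `HodgeFermatThmFstar.lean` / `HodgeFermatThmFstarN.lean`, seats prover-1 gen-0 / gen-2); this file is one link of
the import closure of `PropDPrimeNFinal.propDprime` (the sibling's KR-free chain: THEOREM L, COROLLARY M, THEOREM D6,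
THEOREM U⁺, THEOREM KR6, THEOREM Z3U) on top of those landed chains.  The source module is the sibling's hub-checked module of
record (pub-hodgefermat `CERT.md` l.909, GATE HF-G26; cell record `check/HypUPlus_standalone.lean` sha256 `76158e6cd8cd311b…`); its declarations are copied VERBATIM.
Deviations from the source module, exhaustively: the `import` lines (tree modules `Summits.HodgeConjecture.FermatCycles.
HodgeFermat*` instead of `HodgeFermat.*`); this module docstring; QUALIFIED-NAME SUBSTITUTIONS (name resolution only, forced by the DEDUP deletions in `HodgeFermatHypUTailQB.lean`): `HypUTailQ.log_le_orderOf` (source l.88) → `HypVTail.log_le_orderOf`, `HypUTailQ.list_sum_map_range` (l.298) → `HypVTail.list_sum_map_range` (the landed twins, same statements); likewise the unqualified `prod_range_eq_list` of source l.214 (the source's `HypUOdd.prod_range_eq_list` of `HypUTailOdd.lean` l.313, DEDUP-deleted in `HodgeFermatHypUTailOddB.lean` in favour of the landed VERBATIM twin `HodgeFermat.KRFree.HypVTail.prod_range_eq_list`) is re-bound by the added line `open HodgeFermat.KRFree.HypVTail (prod_range_eq_list)` after the source's `open` lines (l.40–41), so that l.214 stays byte-identical; one-line docstrings added (gate lint)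 to `tau_eq_tauAt`, `npart_of_squarefree`, `tauP_of_squarefree`, `goodP_iff_good`, `goodP_of_good`; the file ends at source l.316 with an `end` line (parts 2, 3 = `HodgeFermatHypUPlusB/C.lean`).
Every other line — in particular every declaration's statement and proof — is byte-identical to the source.
HONEST FRAMING: explicit algebraic cycles for specific Hodge classes on Fermat/Delsarte varieties; residual open instances
listed; no claim on general Hodge.  (This file is arithmetic of CM types / finite combinatorics / analytic number theory
of the sibling's KR-free programme; it claims nothing about cycles.)

The source module's docstring (HypUPlus.lean l.6–34), verbatim:

## LEMMA S⁺ — the level inequality at EVERY odd level, squarefree or not (HF-G26)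

Generations 21–25 certified LEMMA S (`U(N) < 1/6`, i.e. `6 · Σ_{p ∣ N} τ(N, p) < φ(N)`) at every SQUAREFREE
odd level `N ∉ {21, 39}` (`HypUOdd.GoodOdd`), with `τ(N, p)` read modulo the cofactor `N / p`.  The analytic
chain never needed squarefreeness: `HypBReduction.card_K_mul_orderOf` / `even_of_mem_K` count the characters
of `K_p = subgroupOfPrimitiveMapToOne ℂ N p` through the GENERAL cofactor `n_p = N / p ^ v_p(N)`, and
`Squarefree N` entered only to rewrite `n_p = N / p` (`two_mul_card_oddK_le`).  This module supplies the
elementary half at a general level (paper §1 (xvi), `tables/NSF-COINCIDENCES.md` §5):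

* §1 `npart N p = N / p ^ v_p(N)`, `tauAt p m`, `tauP N p = tauAt p (npart N p)` (`= tau N p` at a
  squarefree level: `tauP_of_squarefree`), `GoodP N : 6 · Σ_{p ∣ N} tauP N p < φ(N)`;
* §2 the TAIL at every odd level: `goodTailP : ¬ 2 ∣ N → XK #primeFactors < N → GoodP N` — the numeric
  key lemma `HypUTailOdd.key` (unchanged, thresholds `XK` unchanged) fed with the exponent device
  `⌊log_p N⌋ ≤ D_p := p ^ (v_p - 1) · ord_{n_p}(p)` (`log_le_Dp`) and `φ(N) = p^(v_p-1) (p-1) φ(n_p)`;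
* §3 certificates at a general level: `checkLevelP N fs pcs` over the factor list `fs = [(p, v_p)]`
  (`valOf fs = N`), reusing `powMod` / `checkOrd` / `isPrimeB` of `HypUCert`; soundness `goodP_of_checkLevelP`;
* §4 the certificate generator `autoPCP` (linear search, then the exact order from `λ(n_p)`), the step
  `stepN` (certified squarefree ⇒ nothing to do; certified beyond `XK` ⇒ `goodTailP`; else the certificate),
  the plain walk `walkN`, the range statement `NRange a b` (every NON-squarefree odd `N ∈ [a, b)` is `GoodP`),
  `nRange_of_walkN`, a kernel test `nRange_test : NRange 1 400`; the walk actually used for the range, over the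
  odd multiples of the prime squares (`stepSq`, `walkMul` / `MulCover q a b`, `walkSq` / `SqCover B ps`,
  `nRange_of_sqCover : B ≤ 1601² → SqCover B smallPrimes → NRange 1 B`);
* §5 LEMMA S⁺: `GoodOddP := ∀ N > 1 odd, N ∉ {21, 39} → GoodP N`, as a function of `GoodOdd` and of
  `NRange 1 100001` (`goodOddP_of`, `goodOddP_of_ranges`); the exceptions stay genuine (`not_goodP_21/39`).

Everything here is elementary (no analytic import).  The walk itself (`HypURangeN.nRange_1_100001`) and the
consequences for LEMMA W / THEOREM U (`TheoremUPlus.lean`) are separate modules.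
-/

set_option autoImplicit false

namespace HodgeFermat.KRFree.HypUPlus

open Finset HodgeFermat.KRFree.HypBReduction HodgeFermat.KRFree.HypUCert HodgeFermat.KRFree.HypUAuto
open HodgeFermat.KRFree.HypUOdd
open HodgeFermat.KRFree.HypVTail (prod_range_eq_list)

/-! ## §1 The general cofactor, `tauP`, `GoodP` -/

/-- the cofactor `n_p(N) = N / p ^ v_p(N)` (Mathlib's `ordCompl[p] N`). -/
def npart (N p : ℕ) : ℕ := N / p ^ N.factorization p

open Classical in
/-- `τ` read modulo an arbitrary modulus `m`: `0` if `-1` is a power of `p` mod `m`, else `φ(m) / ord_m(p)`. -/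
noncomputable def tauAt (p m : ℕ) : ℕ :=
  if ∃ k : ℕ, ((p : ℕ) : ZMod m) ^ k = -1 then 0 else m.totient / orderOf ((p : ℕ) : ZMod m)

/-- `τ⁺(N, p) = τ` read modulo the general cofactor `n_p = N / p ^ v_p(N)`. -/
noncomputable def tauP (N p : ℕ) : ℕ := tauAt p (npart N p)

/-- the level inequality at a general level: `6 · Σ_{p ∣ N} τ⁺(N, p) < φ(N)` (`U(N) < 1/6`). -/
def GoodP (N : ℕ) : Prop := 6 * ∑ p ∈ N.primeFactors, tauP N p < N.totient

/-- `tau N p` is `tauAt p (N / p)` by definition -/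
theorem tau_eq_tauAt (N p : ℕ) : tau N p = tauAt p (N / p) := rfl

/-- at a squarefree level the cofactor `npart N p` is `N / p` -/
theorem npart_of_squarefree {N p : ℕ} (hsq : Squarefree N) (hp : p ∈ N.primeFactors) :
    npart N p = N / p := by
  have hN0 : N ≠ 0 := fun h => by subst h; exact not_squarefree_zero hsq
  have hpp := Nat.prime_of_mem_primeFactors hp
  have hfac : N.factorization p = 1 := by
    have h1 := (Nat.squarefree_iff_factorization_le_one hN0).mp hsq p
    have h2 := hpp.factorization_pos_of_dvd hN0 (Nat.dvd_of_mem_primeFactors hp)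
    omega
  rw [npart, hfac, pow_one]

/-- at a squarefree level `tauP = tau` -/
theorem tauP_of_squarefree {N p : ℕ} (hsq : Squarefree N) (hp : p ∈ N.primeFactors) :
    tauP N p = tau N p := by
  rw [tauP, npart_of_squarefree hsq hp, tau_eq_tauAt]

/-- at a squarefree level `GoodP ↔ Good` -/
theorem goodP_iff_good {N : ℕ} (hsq : Squarefree N) : GoodP N ↔ Good N := by
  have e : ∑ p ∈ N.primeFactors, tauP N p = ∑ p ∈ N.primeFactors, tau N p :=
    Finset.sum_congr rfl (fun p hp => tauP_of_squarefree hsq hp)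
  unfold GoodP Good
  rw [e]

/-- at a squarefree level `Good → GoodP` -/
theorem goodP_of_good {N : ℕ} (hsq : Squarefree N) (h : Good N) : GoodP N := (goodP_iff_good hsq).mpr h

/-! ## §2 The tail at every odd level -/

/-- `m < p ^ ord_m(p)` for `p` prime to `m > 0`. -/
theorem lt_pow_orderOf {p m : ℕ} (hp : p.Prime) (hcop : Nat.Coprime p m) (hm : 0 < m) :
    m < p ^ orderOf ((p : ℕ) : ZMod m) := by
  have h1 := HypVTail.log_le_orderOf p m hp hcop hm
  have h2 : p * m < p ^ (Nat.log p (p * m) + 1) := Nat.lt_pow_succ_log_self hp.one_lt _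
  have h3 : p ^ (Nat.log p (p * m) + 1) ≤ p ^ (orderOf ((p : ℕ) : ZMod m) + 1) :=
    Nat.pow_le_pow_right hp.pos (by omega)
  have h4 : p * m < p * p ^ orderOf ((p : ℕ) : ZMod m) := by
    rw [← pow_succ']; exact lt_of_lt_of_le h2 h3
  exact Nat.lt_of_mul_lt_mul_left h4

/-- THE EXPONENT DEVICE at a general level: `⌊log_p N⌋ ≤ D_p := p ^ (v_p(N) - 1) · ord_{n_p}(p)`
(`n_p ∣ p^{ord} - 1` gives `N = p^v n_p < p^(v + ord)`, and `v + ord - 1 ≤ p^(v-1) · ord`). -/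
theorem log_le_Dp {N p : ℕ} (hp : p.Prime) (hpN : p ∣ N) (hN : N ≠ 0) :
    Nat.log p N ≤ p ^ (N.factorization p - 1) * orderOf ((p : ℕ) : ZMod (npart N p)) := by
  have hv1 : 1 ≤ N.factorization p := hp.factorization_pos_of_dvd hN hpN
  have hcop : Nat.Coprime p (npart N p) := Nat.coprime_ordCompl hp hN
  have hn0 : 0 < npart N p := Nat.ordCompl_pos p hN
  have hNeq : p ^ N.factorization p * npart N p = N := Nat.ordProj_mul_ordCompl_eq_self N p
  have hnd : npart N p < p ^ orderOf ((p : ℕ) : ZMod (npart N p)) := lt_pow_orderOf hp hcop hn0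
  generalize hv : N.factorization p = v at *
  generalize hd : orderOf ((p : ℕ) : ZMod (npart N p)) = d at *
  have hd1 : 1 ≤ d := by
    rcases Nat.eq_zero_or_pos d with h0 | h0
    · rw [h0, pow_zero] at hnd; omega
    · exact h0
  have hlt : N < p ^ (v + d) := by
    rw [← hNeq, pow_add]
    exact (Nat.mul_lt_mul_left (pow_pos hp.pos v)).mpr hnd
  have hlog : Nat.log p N < v + d := Nat.log_lt_of_lt_pow hN hlt
  have hpv : v ≤ p ^ (v - 1) := by
    have : v - 1 < p ^ (v - 1) := Nat.lt_pow_self hp.one_lt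
    omega
  have h1 : v * d ≤ p ^ (v - 1) * d := Nat.mul_le_mul_right d hpv
  have h2 : v + d ≤ v * d + 1 := by
    obtain ⟨v', rfl⟩ : ∃ v', v = v' + 1 := ⟨v - 1, by omega⟩
    obtain ⟨d', rfl⟩ : ∃ d', d = d' + 1 := ⟨d - 1, by omega⟩
    nlinarith [Nat.zero_le (v' * d')]
  omega

/-- `τ⁺(N, p) ≤ φ(n_p) / d` for any `0 < d ≤ ord_{n_p}(p)`. -/
theorem tauP_le (N p d : ℕ) (hd : 0 < d) (hdo : d ≤ orderOf ((p : ℕ) : ZMod (npart N p))) :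
    (tauP N p : ℝ) ≤ ((npart N p).totient : ℝ) / d := by
  unfold tauP tauAt
  split_ifs with h
  · simp only [Nat.cast_zero]; positivity
  · calc (((npart N p).totient / orderOf ((p : ℕ) : ZMod (npart N p)) : ℕ) : ℝ)
        ≤ ((npart N p).totient : ℝ) / (orderOf ((p : ℕ) : ZMod (npart N p)) : ℝ) := Nat.cast_div_le
      _ ≤ ((npart N p).totient : ℝ) / d := by
          apply div_le_div_of_nonneg_left (by positivity) (by exact_mod_cast hd)
          exact_mod_cast hdo

/-- `φ(N) = p^(v_p - 1) · (p - 1) · φ(n_p)`. -/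
theorem totient_eq_npart {N p : ℕ} (hp : p.Prime) (hpN : p ∣ N) (hN : N ≠ 0) :
    N.totient = p ^ (N.factorization p - 1) * (p - 1) * (npart N p).totient := by
  have hcop : Nat.Coprime (p ^ N.factorization p) (N / p ^ N.factorization p) :=
    (Nat.coprime_ordCompl hp hN).pow_left _
  have hv : 0 < N.factorization p := hp.factorization_pos_of_dvd hN hpN
  have e : N.totient = (p ^ N.factorization p * (N / p ^ N.factorization p)).totient := by
    rw [Nat.ordProj_mul_ordCompl_eq_self N p]
  rw [e, Nat.totient_mul hcop, Nat.totient_prime_pow hp hv]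
  rfl

/-- THE TAIL at a general level: the level inequality at every ODD level beyond the threshold of its number
of prime factors — squarefree or not (structure of `HypUTailOdd.goodTail`, exponent floors `dd (L k) S p`
now bounded by `D_p` instead of `ord_{N/p}(p)`). -/
theorem goodTailP (N : ℕ) (h2 : ¬ 2 ∣ N) (hX : XK N.primeFactors.card < N) : GoodP N := by
  have hN0 : N ≠ 0 := by omega
  have hN : 1 < N := by
    by_contra h
    have h1 : N = 1 := by omega
    subst h1
    simp [XK] at hX
  set S := N.primeFactors with hS
  have hprodle : ∏ q ∈ S, q ≤ N := Nat.le_of_dvd (by omega) (Nat.prod_primeFactors_dvd N)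
  have hmemS : ∀ p ∈ S, p.Prime ∧ p ∣ N := fun p hp =>
    ⟨Nat.prime_of_mem_primeFactors hp, Nat.dvd_of_mem_primeFactors hp⟩
  have hge3 : ∀ p ∈ S, 3 ≤ p ∧ p % 2 = 1 := by
    intro p hp
    obtain ⟨hpr, hdvd⟩ := hmemS p hp
    have hp2 : p ≠ 2 := fun h => h2 (h ▸ hdvd)
    have hodd : p % 2 = 1 := hpr.eq_two_or_odd.resolve_left hp2
    have := hpr.two_le
    exact ⟨by omega, hodd⟩
  have hcop : ∀ p ∈ S, Nat.Coprime p (npart N p) := fun p hp => Nat.coprime_ordCompl (hmemS p hp).1 hN0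
  have htot : ∀ p ∈ S, (N.totient : ℝ) =
      ((p : ℝ) ^ (N.factorization p - 1)) * (((p : ℝ) - 1) * ((npart N p).totient : ℝ)) := by
    intro p hp
    obtain ⟨hpr, hdvd⟩ := hmemS p hp
    rw [totient_eq_npart hpr hdvd hN0]; push_cast [Nat.cast_sub hpr.one_lt.le]; ring
  have hbN : ∀ p ∈ S, p ^ (S.filter (fun q => p ≤ q)).card ≤ N := by
    intro p hp
    calc p ^ (S.filter (fun q => p ≤ q)).card ≤ ∏ q ∈ S.filter (fun q => p ≤ q), q :=
          Finset.pow_card_le_prod _ _ _ (fun q hq => (Finset.mem_filter.mp hq).2)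
      _ ≤ ∏ q ∈ S, q := Finset.prod_le_prod_of_subset_of_one_le' (Finset.filter_subset _ _)
          (fun q hq _ => (hmemS q hq).1.one_lt.le)
      _ ≤ N := hprodle
  -- the sorted list of prime factors and the size bound `L k ≤ N`
  set l := S.sort (fun a b => a ≤ b) with hl
  set k := l.length with hk
  have hkS : k = S.card := by rw [hk, hl, Finset.length_sort]
  have hSne : S.Nonempty := Nat.nonempty_primeFactors.mpr hN
  have hk0 : 0 < k := by rw [hkS]; exact Finset.card_pos.mpr hSne
  have hgetD : ∀ i, (hi : i < k) → l.getD i 0 = l.get ⟨i, by omega⟩ := by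
    intro i hi
    rw [List.getD_eq_getElem l 0 hi]; rfl
  have hmem : ∀ i, i < k → l.getD i 0 ∈ S := by
    intro i hi
    rw [hgetD i hi]
    exact (Finset.mem_sort (fun a b => a ≤ b)).mp (List.get_mem l _)
  have hmono : ∀ i j, i < j → j < k → l.getD i 0 < l.getD j 0 := by
    intro i j hij hjk
    have hsm : StrictMono l.get := Finset.sortedLT_sort S
    rw [hgetD i (by omega), hgetD j hjk]
    exact hsm (show (⟨i, by omega⟩ : Fin l.length) < ⟨j, by omega⟩ from hij)
  have hpf : ∀ i, i < k → qt i ≤ l.getD i 0 := by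
    intro i
    induction i with
    | zero => intro h0; have := (hge3 _ (hmem 0 h0)).1; rw [qt_zero]; exact this
    | succ i ih =>
        intro hi
        exact qt_step i _ _ (ih (by omega)) (hmono i (i + 1) (by omega) hi)
          (hge3 _ (hmem i (by omega))).2 (hge3 _ (hmem (i + 1) hi)).2 (hmemS _ (hmem (i + 1) hi)).1
  have hlN : l.prod ≤ N := by
    have h1 : l.prod = S.toList.prod := (Finset.sort_perm_toList S (fun a b => a ≤ b)).prod_eq
    have h2 : (S.toList.map (fun q => q)).prod = ∏ q ∈ S, q := Finset.prod_map_toList S (fun q => q)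
    rw [List.map_id'] at h2
    rw [h1, h2]; exact hprodle
  have hQN : Q k ≤ N := by
    calc Q k = ∏ i ∈ range k, qt i := (prod_range_eq_list qt k).symm
      _ ≤ ∏ i ∈ range k, l.getD i 0 :=
          Finset.prod_le_prod' (fun i hi => hpf i (mem_range.mp hi))
      _ = l.prod := (list_prod_range l).symm
      _ ≤ N := hlN
  have hLN : L k ≤ N := by
    have hXk : XK k < N := by rw [hkS]; exact hX
    exact max_le hXk.le (le_trans (min_le_left _ _) hQN)
  -- exponent floors `dd (L k) S p ≤ D_p`
  have hdpos : ∀ p ∈ S, 0 < dd (L k) S p := by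
    intro p hp
    have : 0 < (S.filter (fun q => p ≤ q)).card :=
      Finset.card_pos.mpr ⟨p, Finset.mem_filter.mpr ⟨hp, le_rfl⟩⟩
    exact lt_of_lt_of_le this (le_max_right _ _)
  have hdo : ∀ p ∈ S, dd (L k) S p ≤
      p ^ (N.factorization p - 1) * orderOf ((p : ℕ) : ZMod (npart N p)) := by
    intro p hp
    obtain ⟨hpr, hdvd⟩ := hmemS p hp
    refine le_trans (max_le ?_ ?_) (log_le_Dp hpr hdvd hN0)
    · exact Nat.log_mono_right hLN
    · exact Nat.le_log_of_pow_le hpr.one_lt (hbN p hp)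
  -- one term
  have hterm : ∀ p ∈ S, (6 : ℝ) * (tauP N p : ℝ) ≤
      (N.totient : ℝ) * (6 / ((((p - 1 : ℕ) : ℝ)) * (dd (L k) S p : ℝ))) := by
    intro p hp
    obtain ⟨hpr, hdvd⟩ := hmemS p hp
    have hordpos : 0 < orderOf ((p : ℕ) : ZMod (npart N p)) := by
      haveI : NeZero (npart N p) := ⟨(Nat.ordCompl_pos p hN0).ne'⟩
      rw [← ZMod.coe_unitOfCoprime p (hcop p hp), orderOf_units]
      exact orderOf_pos _
    have ht := tauP_le N p _ hordpos le_rfl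
    have hp1 : (0 : ℝ) < (p : ℝ) - 1 := by
      have : (2 : ℝ) ≤ p := by exact_mod_cast hpr.two_le
      linarith
    have hdp : (0 : ℝ) < (dd (L k) S p : ℝ) := by exact_mod_cast hdpos p hp
    have hD : (dd (L k) S p : ℝ) ≤
        ((p : ℝ) ^ (N.factorization p - 1)) * (orderOf ((p : ℕ) : ZMod (npart N p)) : ℝ) := by
      exact_mod_cast hdo p hp
    have hP : (0 : ℝ) < (p : ℝ) ^ (N.factorization p - 1) := pow_pos (by exact_mod_cast hpr.pos) _
    have hF : (0 : ℝ) ≤ ((npart N p).totient : ℝ) := by positivity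
    have ho : (0 : ℝ) < (orderOf ((p : ℕ) : ZMod (npart N p)) : ℝ) := by exact_mod_cast hordpos
    have step : ((npart N p).totient : ℝ) / (orderOf ((p : ℕ) : ZMod (npart N p)) : ℝ) ≤
        ((p : ℝ) ^ (N.factorization p - 1)) * ((npart N p).totient : ℝ) / (dd (L k) S p : ℝ) := by
      rw [div_le_div_iff₀ ho hdp]
      calc ((npart N p).totient : ℝ) * (dd (L k) S p : ℝ)
          ≤ ((npart N p).totient : ℝ) *
            (((p : ℝ) ^ (N.factorization p - 1)) * (orderOf ((p : ℕ) : ZMod (npart N p)) : ℝ)) :=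
            mul_le_mul_of_nonneg_left hD hF
        _ = ((p : ℝ) ^ (N.factorization p - 1)) * ((npart N p).totient : ℝ) *
            (orderOf ((p : ℕ) : ZMod (npart N p)) : ℝ) := by ring
    rw [htot p hp, Nat.cast_sub hpr.one_lt.le, Nat.cast_one]
    have e : ((p : ℝ) ^ (N.factorization p - 1)) * (((p : ℝ) - 1) * ((npart N p).totient : ℝ)) *
        (6 / (((p : ℝ) - 1) * (dd (L k) S p : ℝ))) =
        6 * (((p : ℝ) ^ (N.factorization p - 1)) * ((npart N p).totient : ℝ) / (dd (L k) S p : ℝ)) := by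
      field_simp
    rw [e]
    linarith
  -- ranks
  have hcard : ∀ i, i < k → k - i ≤ (S.filter (fun q => l.getD i 0 ≤ q)).card := by
    intro i hi
    rw [← Nat.card_Ico i k]
    apply Finset.card_le_card_of_injOn (fun j => l.getD j 0)
    · intro j hj
      have hj' := Finset.mem_Ico.mp (Finset.mem_coe.mp hj)
      refine Finset.mem_coe.mpr (Finset.mem_filter.mpr ⟨hmem j hj'.2, ?_⟩)
      rcases Nat.eq_or_lt_of_le hj'.1 with h | h
      · rw [h]
      · exact (hmono i j h hj'.2).le
    · intro j₁ hj₁ j₂ hj₂ heq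
      have h1 := (Finset.mem_Ico.mp (Finset.mem_coe.mp hj₁)).2
      have h2 := (Finset.mem_Ico.mp (Finset.mem_coe.mp hj₂)).2
      rcases lt_trichotomy j₁ j₂ with h | h | h
      · exact absurd heq (ne_of_lt (hmono _ _ h h2))
      · exact h
      · exact absurd heq.symm (ne_of_lt (hmono _ _ h h1))
  have hkey := key k hk0 (fun i => l.getD i 0) (fun i => dd (L k) S (l.getD i 0)) hpf
    (fun i hi => (hge3 _ (hmem i hi)).2)
    (fun i _ => le_max_left _ _) (fun i hi => le_trans (hcard i hi) (le_max_right _ _))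
  have hsum : ∑ p ∈ S, (6 : ℝ) / ((((p - 1 : ℕ) : ℝ)) * (dd (L k) S p : ℝ)) =
      ∑ i ∈ range k, (6 : ℝ) / ((((l.getD i 0 - 1 : ℕ) : ℝ)) * (dd (L k) S (l.getD i 0) : ℝ)) := by
    have h1 : ∑ p ∈ S, (6 : ℝ) / ((((p - 1 : ℕ) : ℝ)) * (dd (L k) S p : ℝ)) =
        (l.map (fun p => (6 : ℝ) / ((((p - 1 : ℕ) : ℝ)) * (dd (L k) S p : ℝ)))).sum := by
      rw [← Finset.sum_map_toList S]
      exact (List.Perm.map _ (Finset.sort_perm_toList S (fun a b => a ≤ b))).sum_eq.symm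
    rw [h1, HypVTail.list_sum_map_range]
  rw [← hsum] at hkey
  have htotpos : (0 : ℝ) < (N.totient : ℝ) := by
    exact_mod_cast Nat.totient_pos.mpr (by omega)
  have hfinal : (6 : ℝ) * ∑ p ∈ S, (tauP N p : ℝ) < (N.totient : ℝ) := by
    calc (6 : ℝ) * ∑ p ∈ S, (tauP N p : ℝ) = ∑ p ∈ S, 6 * (tauP N p : ℝ) := by rw [mul_sum]
      _ ≤ ∑ p ∈ S, (N.totient : ℝ) * (6 / ((((p - 1 : ℕ) : ℝ)) * (dd (L k) S p : ℝ))) :=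
          sum_le_sum hterm
      _ = (N.totient : ℝ) * ∑ p ∈ S, (6 / ((((p - 1 : ℕ) : ℝ)) * (dd (L k) S p : ℝ))) := by
          rw [← mul_sum]
      _ < (N.totient : ℝ) * 1 := mul_lt_mul_of_pos_left hkey htotpos
      _ = (N.totient : ℝ) := mul_one _
  unfold GoodP
  exact_mod_cast hfinal

/-- In particular beyond `10⁵` no hypothesis on the number of prime factors remains. -/
theorem goodTailP_100000 (N : ℕ) (h2 : ¬ 2 ∣ N) (hN : 100000 < N) : GoodP N :=
  goodTailP N h2 (lt_of_le_of_lt (XK_le _) hN)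


end HodgeFermat.KRFree.HypUPlus
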